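import Summits.Ventures.CertifiedArithmetic.LowPrec.GemmThetaLawE2M1Edge
import Summits.Ventures.CertifiedArithmetic.LowPrec.GemmThetaE2M1

/-!
# The θ-certificate of E2M1² at every precision `p ≥ 9`: the integer law from the finite checks

HONEST FRAMING (venture CertifiedArithmetic / cell `pub-lowprec`, seat gemm, gen 12): certified error
envelopes and provably optimal rounding/accumulation schemes for low-precision formats under stated
cost models; every table by two implementations; no hardware or vendor claims.

Soundness, part 3, of the symbolic certificate `GemmThetaLawE2M1Defs.lean` (paper `gemm.tex`
§Regimes Thm t:thetap): GIVEN that every valid class passes `clsOK` and every pair table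
`pairTableOK j'`, `j' ≤ 6`, passes (the `decide +kernel` theorems of `GemmThetaLawE2M1Check*.lean`),
the seven facts of the θ-certificate hold IN INTEGERS (quarter units) for every `m ≥ 8`
(`m = p - 1`, `H = 2^(m-1)`): for every state `V ∈ stZ m` and letter `x ∈ lamQ`, with
`W = rneZ m (V + x)`, `δ = W - V - x`, `d = |x| - δ`: closure, the capacity inequality
`(13H + 8)|x| ≤ 32 ψ(V)` at absorbed negative letters, the potential inequality, `2δ ≤ 7d` on paid
moves, and on free moves `(13H + 8)δ ≤ 32 ψ(V)` and `2(δ + δ') ≤ 23 d'` for every next move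
(`lawZ_of_checks`).  Edges inside the exact region `|V|, |V + x| < 2^p` are exact (`δ = 0`) and are
discharged directly; all others are edges of a class (`cover`, `cover_qh`) and follow from
`edge_sound` and `pair_sound`.
-/

namespace Literature.ComputerArithmetic.FloatingPoint

namespace MiniFloat

namespace ThetaLawE2M1

open ThetaE2M1 (lamQ natAbs_le_of_mem_lamQ)
open ThetaLaw

/-- RNE is the identity on `|K| < 2^p`. [folklore] -/
theorem rneZ_of_natAbs_lt {m : ℕ} {K : ℤ} (h : K.natAbs < 2 ^ (m + 1)) : rneZ m K = K := by
  have h1 : rneSigMag m K.natAbs = K.natAbs := by unfold rneSigMag; rw [if_pos h]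
  unfold rneZ; rw [h1]; split <;> omega

/-- `V = sgnZ (V < 0) |V|`. [folklore] -/
theorem sgnZ_natAbs (V : ℤ) : sgnZ (decide (V < 0)) (V.natAbs : ℤ) = V := by
  unfold sgnZ
  by_cases h : V < 0
  · simp only [h, decide_true, if_true]; omega
  · simp only [h, decide_false, Bool.false_eq_true, if_false]; omega

/-- A state has magnitude at most `2^9 M = 2^(m+9)`. [gemm.tex Thm t:thetap (i)] -/
theorem natAbs_le_of_stZ {m : ℕ} {V : ℤ} (hV : stZ m V) : V.natAbs ≤ 2 ^ (m + 9) := by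
  rcases hV with h | ⟨j, t, hj, ht, hV⟩
  · exact le_trans h.le (Nat.pow_le_pow_right (by norm_num) (by omega))
  · rw [hV]
    calc (2 ^ m + t) * 2 ^ (j + 1) ≤ (2 ^ m + 2 ^ m) * 2 ^ 8 :=
          Nat.mul_le_mul (by omega) (Nat.pow_le_pow_right (by norm_num) (by omega))
      _ = 2 ^ (m + 9) := by rw [← two_mul, ← pow_succ', ← pow_add]

/-- Both signs of a passing class give passing edges. [cell] -/
theorem edgeOK_of_clsOK {c : Cls} (h : clsOK c = true) (σ : Bool) {x : ℤ} (hx : x ∈ lamQ) :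
    edgeOK σ c x = true := by
  have h1 := List.all_eq_true.mp h x hx
  rw [Bool.and_eq_true] at h1
  cases σ
  · exact h1.1
  · exact h1.2

/-- EVERY STATE OUTSIDE AN EXACT EDGE IS A SIGNED CLASS VALUE at admissible parameters: either
`|V| ≥ 2^p` (a vertex, by `cover`) or `|V| < 2^p ≤ |V + x|` (then `|V| ≥ 4H - 144`, class `qh`).
[cell] -/
theorem exists_cls_of_state {m : ℕ} {H : ℤ} (hM : (2 : ℤ) ^ m = 2 * H) (hH128 : 128 ≤ H)
    {V x : ℤ} (hV : stZ m V) (hxb : x.natAbs ≤ 144)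
    (hA : ¬ (V.natAbs < 2 ^ (m + 1) ∧ (V + x).natAbs < 2 ^ (m + 1))) :
    ∃ c : Cls, ∃ T : ℤ, ∃ σ : Bool, c.valid ∧ Dom c.hasT H T ∧ V = sgnZ σ (c.valF.eval H T) := by
  have h4H : (((2 ^ (m + 1) : ℕ)) : ℤ) = 4 * H := by push_cast; rw [pow_succ, hM]; ring
  by_cases hV4 : V.natAbs < 2 ^ (m + 1)
  · have hVx : 2 ^ (m + 1) ≤ (V + x).natAbs := not_lt.mp fun h => hA ⟨hV4, h⟩
    have htri : (V + x).natAbs ≤ V.natAbs + x.natAbs := Int.natAbs_add_le V x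
    have hlo : ((2 ^ (m + 1) : ℕ) : ℤ) ≤ (V.natAbs : ℤ) + 144 := by exact_mod_cast (by omega)
    have hhi : (V.natAbs : ℤ) < ((2 ^ (m + 1) : ℕ) : ℤ) := by exact_mod_cast hV4
    rw [h4H] at hlo hhi
    obtain ⟨hc, hd, hval⟩ := cover_qh hH128 (z := (4 * H - V.natAbs).toNat) (by omega) (by omega)
    refine ⟨_, 0, decide (V < 0), hc, hd, ?_⟩
    rw [hval, Int.toNat_of_nonneg (by omega), show 4 * H - (4 * H - (V.natAbs : ℤ)) = V.natAbs by ring]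
    exact (sgnZ_natAbs V).symm
  · rcases hV with h | ⟨j, t, hj, ht, hVeq⟩
    · exact absurd h hV4
    · obtain ⟨c, T, hc, hd, hval⟩ := cover hM hH128 hj ht
      refine ⟨c, T, decide (V < 0), hc, hd, ?_⟩
      rw [hval, ← hVeq]
      exact (sgnZ_natAbs V).symm

/-- THE θ-LAW IN INTEGERS (quarter units) from the finite checks: for `m ≥ 8` (`p ≥ 9`), every state
`V ∈ stZ m` and letter `x ∈ lamQ`, with `H = 2^(m-1)`, `W = rneZ m (V + x)`, `δ = W - V - x`,
`d = |x| - δ` — closure, capacity, potential, paid, free (with the pair inequality for every next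
letter). [cell, gemm.tex Thm t:thetap (iii)] -/
theorem lawZ_of_checks {m : ℕ} (hm8 : 8 ≤ m)
    (hcls : ∀ c : Cls, c.valid → clsOK c = true) (hpair : ∀ jp, jp ≤ 6 → pairTableOK jp = true)
    {V x : ℤ} (hV : stZ m V) (hx : x ∈ lamQ) :
    let H : ℤ := 2 ^ (m - 1)
    let W := rneZ m (V + x)
    let δ := W - V - x
    let d := (x.natAbs : ℤ) - δ
    stZ m W ∧
    (W = V → x < 0 → (13 * H + 8) * -x ≤ 32 * psiZp m V) ∧
    (W ≠ V → psiZp m W ≤ psiZp m V + d) ∧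
    (W ≠ V → 0 < d → 2 * δ ≤ 7 * d) ∧
    (W ≠ V → ¬ 0 < d → (13 * H + 8) * δ ≤ 32 * psiZp m V ∧
      ∀ x', x' ∈ lamQ → rneZ m (W + x') = W ∨
        2 * (δ + (rneZ m (W + x') - W - x')) ≤ 23 * ((x'.natAbs : ℤ) - (rneZ m (W + x') - W - x'))) := by
  intro H W δ d
  have hm1 : 1 ≤ m := by omega
  have hM : (2 : ℤ) ^ m = 2 * H := by
    show (2 : ℤ) ^ m = 2 * 2 ^ (m - 1)
    rw [← pow_succ']; congr 1; omega
  have hH128 : (128 : ℤ) ≤ H := by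
    show (128 : ℤ) ≤ 2 ^ (m - 1)
    calc (128 : ℤ) = 2 ^ 7 := by norm_num
      _ ≤ 2 ^ (m - 1) := pow_le_pow_right₀ (by norm_num) (by omega)
  have hev : (2 : ℤ) ∣ H := by
    show (2 : ℤ) ∣ 2 ^ (m - 1)
    exact dvd_pow_self 2 (by omega)
  have hxb : x.natAbs ≤ 144 := natAbs_le_of_mem_lamQ hx
  by_cases hA : V.natAbs < 2 ^ (m + 1) ∧ (V + x).natAbs < 2 ^ (m + 1)
  · -- an exact edge inside `|v| < 2^p`
    obtain ⟨hV4, hVx4⟩ := hA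
    have hWV : W = V + x := rneZ_of_natAbs_lt hVx4
    have hψV : psiZp m V = (V.natAbs : ℤ) := psiZp_of_natAbs_lt m hV4
    have hψW : psiZp m W = ((V + x).natAbs : ℤ) := by rw [hWV]; exact psiZp_of_natAbs_lt m hVx4
    have htri : (V + x).natAbs ≤ V.natAbs + x.natAbs := Int.natAbs_add_le V x
    refine ⟨Or.inl (by rw [hWV]; exact hVx4), ?_, ?_, ?_, ?_⟩
    · intro hWV' hx0; rw [hWV] at hWV'; omega
    · intro _; rw [hψV, hψW]
      show ((V + x).natAbs : ℤ) ≤ (V.natAbs : ℤ) + ((x.natAbs : ℤ) - (W - V - x))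
      rw [hWV]; omega
    · intro _ _; show 2 * (W - V - x) ≤ 7 * ((x.natAbs : ℤ) - (W - V - x)); rw [hWV]; omega
    · intro hne hd0
      exfalso; apply hne
      change ¬ (0 : ℤ) < (x.natAbs : ℤ) - (W - V - x) at hd0
      rw [hWV] at hd0 ⊢
      have : x = 0 := by omega
      rw [this, add_zero]
  · -- an edge of a class
    obtain ⟨c, T, σ, hc, hd, hVeq⟩ := exists_cls_of_state hM hH128 hV hxb hA
    subst hVeq
    have hok : edgeOK σ c x = true := edgeOK_of_clsOK (hcls c hc) σ hx
    have E := edge_sound hm1 hM hH128 hev hc hd hok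
    obtain ⟨E1, E2, E3, E4, E5⟩ := E
    refine ⟨E1, E2, E3, E4, fun hne hdnp => ?_⟩
    obtain ⟨-, hκ, jp, t, hjp, ht0, ht, h2t, hδ, hWeq⟩ := E5 hne hdnp
    refine ⟨hκ, fun x' hx' => ?_⟩
    have P := pair_sound hM hH128 hev (hpair jp hjp) ht0 ht h2t σ hx'
    simp only at P
    change rneZ m (sgnZ σ (c.valF.eval H T) + x) = sgnZ σ ((2 * H + t) * 2 ^ (jp + 1)) at hWeq
    rw [← hWeq] at P
    rcases P with P | P
    · exact Or.inl P
    · right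
      have h2 : (2 : ℤ) ^ (jp + 1) = 2 * 2 ^ jp := by rw [pow_succ]; ring
      change rneZ m (sgnZ σ (c.valF.eval H T) + x) - sgnZ σ (c.valF.eval H T) - x ≤ 2 ^ jp at hδ
      linarith

end ThetaLawE2M1

end MiniFloat

end Literature.ComputerArithmetic.FloatingPoint
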